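import Summits.QuantumFields.BalabanUV.Beta.GAN24.WoodburyFibreZeroModeOsc

/-!
# GAN24 / WoodburyFibreZeroSumGain — the OTHER first-order mechanism of the W∕T₂ slot, kernel-level atom: a LOCALISED source with ZERO total sum
# composed with a leg that is smooth (forward differences `≤ ε·e^{−δ|·|₁}`) is bi-localised with constant `∝ C_X·ε` — the leg's SIZE never enters
# («order 0 = legs(centre)·Z(X) = 0, order 1 = ∇leg × first moment» of `SKELETON-W3.md` §7.3 (T-irr), for ONE leg; census row V14 of
# `HOME/b2b-balaban-gan24-p3/WOODBURY-FIBRE.md` v8.4; binder row G-an2-4 ∕ (CONV-C), P3, gen 8)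

Cell `pub-balaban`, β sub-cell.  HONEST FRAMING (verbatim): discharging `BetaPertH` makes Bałaban's UV stability UNCONDITIONAL — a real
constructive-QFT result; it is NOT the continuum limit and NOT the Clay problem.  HONEST DEPENDENCY (verbatim): continuum YM on T⁴ ⇐
BetaPertH ∧ nine spine estimates (0/9 proved); BetaPertH ⇐ (D1) ∧ (D4) ∧ CAP+tail; G-an2-4 gates asym, D1 and NE2/3/4.  NOT IN PRINT; OUR
BOOKKEEPING.  [folklore] over an2's `ExpKernelCalculus` (`BiLoc`, `comp`, `Zl`, `summable_exp_shift'`, `tsum_exp_shift'`) and this lineage's walk lemmas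
(`WoodburyFibreZeroModeOsc.abs_sub_of_offset`) BY NAME; cites nothing, mints no `def … : Prop`, instantiates no wall binder; every datum is a HYPOTHESIS.
It is the ONE-LEG atom of (T-irr), not (T-irr) itself (which is a statement about the 4-leg transport `Push4.push₄` of road P1 — the row owner's rows
W3-F3); discharges NOTHING of (CONV-C), the W-slot, «T2Shape», (D1); NEVER «G-an2-4 closed»; NOT BetaPertH, NOT continuum, NOT Clay.

## Contents (all [folklore]; any dimension `D`, finite fibre `F`)
* §1 TWO-SIDED WALK: `posPart`∕`negPart` of an integer offset, `toSite_posPart_sub_negPart`, `sum_posPart_add_negPart` (`= |y − c|₁`);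
  **`abs_sub_le_of_fwdDiff`**: `|g(w + e_μ) − g(w)| ≤ ε·e^{−δ|w−z|₁}` (all μ, w) ⇒ `|g y − g c| ≤ |y−c|₁·ε·e^{3δ|y−c|₁}·e^{−δ|y−z|₁}` for ARBITRARY `y, c` (two nonnegative
  walks from the corner `c − (y−c)⁻`).
* §2 `mul_exp_neg_le` (`t·e^{−κt} ≤ (2/κ)·e^{−(κ/2)t}`, `κ > 0`), **`abs_comp_zeroSum_le`** ∕ **`biLoc_comp_of_zeroSum`**: `BiLoc X p q C_X δ_X` with ZERO SUMS in
  the contracted variable (`∀ x a f, Σ'_y X x y a f = 0`), a bounded right leg `J` with forward differences `≤ ε·e^{−δ|y−z|₁}` in its first variable, `0 ≤ δ`,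
  `4δ < δ_X` ⇒ `BiLoc (comp X J) p q (|F|·C_X·ε·(δ_X − 4δ)⁻¹·Zl_D((δ_X − 4δ)/2)) δ` — localised at `p` in the free variable of `X`, decaying from `q` at the
  leg's rate in the free variable of `J`, constant LINEAR in `ε`.
READING: for a block-covariant level-m source with `Z(X) = 0` against a composite leg with `ε ~ Lc^{−(n−m)}` ((N1′)-type, cf. `WoodburyFibreZeroModeMinimiserLeg`)
this is the `ρ^{n−m}` of (T-irr) for one leg; the 4-leg version distributes the first Taylor order over the legs (owner's rows).
-/

noncomputable section

open Finset
open scoped BigOperators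
open Literature.MathematicalPhysics.QuantumFieldTheory
open Literature.MathematicalPhysics.QuantumFieldTheory.Balaban1983to89
open Literature.MathematicalPhysics.QuantumFieldTheory.Balaban1983to89.Beta
open B12Sec2to5 (l1 l1_nonneg)
open ExpKernelCalculus (MKer Decays BiLoc comp Zl summable_exp_shift' tsum_exp_shift' l1_sub_triangle l1_sub_symm)
open KernelWard (Bdd)
open AffineAveraging (unitVec toSite)
open Summit.QuantumFields.BalabanUV.Beta.GAN24.WoodburyFibreZeroModeOsc (abs_sub_of_offset partOff_univ l1_partOff exp_weight_shift)

namespace Summit.QuantumFields.BalabanUV.Beta.GAN24.WoodburyFibreZeroSumGain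

/-! ## §1 The two-sided walk -/

section Walk

variable {D : ℕ}

/-- Positive part of an integer offset, coordinatewise, as naturals. [folklore] -/
def posPart (v : Fin D → ℤ) : Fin D → ℕ := fun j => (v j).toNat

/-- Negative part of an integer offset, coordinatewise, as naturals. [folklore] -/
def negPart (v : Fin D → ℤ) : Fin D → ℕ := fun j => (-v j).toNat

/-- `toSite v⁺ − toSite v⁻ = v`. [folklore] -/
theorem toSite_posPart_sub_negPart (v : Fin D → ℤ) : toSite (posPart v) - toSite (negPart v) = v := by
  funext j
  simp only [Pi.sub_apply, toSite, posPart, negPart]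
  omega

/-- `Σ_j v⁺_j + Σ_j v⁻_j = |v|₁`. [folklore] -/
theorem sum_posPart_add_negPart (v : Fin D → ℤ) :
    ∑ j, ((posPart v j : ℕ) : ℝ) + ∑ j, ((negPart v j : ℕ) : ℝ) = l1 v := by
  rw [← Finset.sum_add_distrib]
  refine Finset.sum_congr rfl fun j _ => ?_
  simp only [posPart, negPart]
  have h : ((v j).toNat : ℤ) + ((-v j).toNat : ℤ) = |v j| := by
    rcases le_total 0 (v j) with h0 | h0
    · rw [Int.toNat_of_nonneg h0, Int.toNat_eq_zero.mpr (by linarith), abs_of_nonneg h0]; simp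
    · rw [Int.toNat_eq_zero.mpr h0, Int.toNat_of_nonneg (by linarith), abs_of_nonpos h0]; simp
  have h' : (((v j).toNat : ℕ) : ℝ) + (((-v j).toNat : ℕ) : ℝ) = ((|v j| : ℤ) : ℝ) := by exact_mod_cast h
  rw [h', Int.cast_abs]

/-- **TWO-SIDED WALK**: a forward-difference bound `|g(w + e_μ) − g(w)| ≤ ε·e^{−δ|w − z|₁}` (all `μ`, `w`) gives, for ARBITRARY `y, c`,
`|g y − g c| ≤ |y − c|₁·ε·e^{3δ|y − c|₁}·e^{−δ|y − z|₁}`. [folklore] -/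
theorem abs_sub_le_of_fwdDiff {g : (Fin D → ℤ) → ℝ} {ε δ : ℝ} {z : Fin D → ℤ} (hε : 0 ≤ ε) (hδ : 0 ≤ δ)
    (hD : ∀ μ w, |g (w + unitVec μ) - g w| ≤ ε * Real.exp (-δ * l1 (w - z))) (y c : Fin D → ℤ) :
    |g y - g c| ≤ l1 (y - c) * ε * Real.exp (3 * δ * l1 (y - c)) * Real.exp (-δ * l1 (y - z)) := by
  set v := y - c with hv
  set c' := c - toSite (negPart v) with hc'
  set Lp : ℝ := ∑ j, ((posPart v j : ℕ) : ℝ) with hLp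
  set Ln : ℝ := ∑ j, ((negPart v j : ℕ) : ℝ) with hLn
  have hLp0 : 0 ≤ Lp := Finset.sum_nonneg fun j _ => Nat.cast_nonneg _
  have hLn0 : 0 ≤ Ln := Finset.sum_nonneg fun j _ => Nat.cast_nonneg _
  have hsum : Lp + Ln = l1 v := sum_posPart_add_negPart v
  have hy : c' + toSite (posPart v) = y := by
    have := toSite_posPart_sub_negPart v
    rw [hc', hv] at *
    have e : c - toSite (negPart (y - c)) + toSite (posPart (y - c)) = c + (toSite (posPart (y - c)) - toSite (negPart (y - c))) := by abel
    rw [e, this]; abel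
  have hc : c' + toSite (negPart v) = c := by rw [hc']; abel
  -- the two nonnegative walks from the corner `c'`
  have h1 := abs_sub_of_offset (g := g) (z := z) hε hδ hD hy (le_refl Lp)
  have h2 := abs_sub_of_offset (g := g) (z := z) hε hδ hD hc (le_refl Ln)
  -- re-centre the weight of the second walk from `c` to `y`: `e^{−δ|c−z|} ≤ e^{δ|v|}e^{−δ|y−z|}`
  have hw : Real.exp (-δ * l1 (c - z)) ≤ Real.exp (δ * l1 v) * Real.exp (-δ * l1 (y - z)) := by
    have := exp_weight_shift hδ y (c - y) z
    rw [show y + (c - y) = c by abel, l1_sub_symm c y, ← hv] at this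
    exact this
  have hE : 0 ≤ Real.exp (-δ * l1 (y - z)) := (Real.exp_pos _).le
  have hLpL : Lp ≤ l1 v := by linarith
  have hLnL : Ln ≤ l1 v := by linarith
  have e1 : Real.exp (2 * δ * Lp) ≤ Real.exp (3 * δ * l1 v) := Real.exp_le_exp.mpr (by nlinarith [l1_nonneg v])
  have e2 : Real.exp (2 * δ * Ln) * Real.exp (δ * l1 v) ≤ Real.exp (3 * δ * l1 v) := by
    rw [← Real.exp_add]; exact Real.exp_le_exp.mpr (by nlinarith)
  calc |g y - g c| = |(g y - g c') - (g c - g c')| := by ring_nf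
    _ ≤ |g y - g c'| + |g c - g c'| := abs_sub _ _
    _ ≤ Lp * ε * Real.exp (2 * δ * Lp) * Real.exp (-δ * l1 (y - z)) + Ln * ε * Real.exp (2 * δ * Ln) * Real.exp (-δ * l1 (c - z)) :=
        add_le_add h1 h2
    _ ≤ Lp * ε * Real.exp (3 * δ * l1 v) * Real.exp (-δ * l1 (y - z))
          + Ln * ε * (Real.exp (2 * δ * Ln) * Real.exp (δ * l1 v)) * Real.exp (-δ * l1 (y - z)) := by
        refine add_le_add ?_ ?_
        · exact mul_le_mul_of_nonneg_right (mul_le_mul_of_nonneg_left e1 (by positivity)) hE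
        · calc Ln * ε * Real.exp (2 * δ * Ln) * Real.exp (-δ * l1 (c - z))
              ≤ Ln * ε * Real.exp (2 * δ * Ln) * (Real.exp (δ * l1 v) * Real.exp (-δ * l1 (y - z))) :=
                mul_le_mul_of_nonneg_left hw (by positivity)
            _ = Ln * ε * (Real.exp (2 * δ * Ln) * Real.exp (δ * l1 v)) * Real.exp (-δ * l1 (y - z)) := by ring
    _ ≤ Lp * ε * Real.exp (3 * δ * l1 v) * Real.exp (-δ * l1 (y - z)) + Ln * ε * Real.exp (3 * δ * l1 v) * Real.exp (-δ * l1 (y - z)) := by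
        refine add_le_add le_rfl (mul_le_mul_of_nonneg_right (mul_le_mul_of_nonneg_left e2 (by positivity)) hE)
    _ = l1 v * ε * Real.exp (3 * δ * l1 v) * Real.exp (-δ * l1 (y - z)) := by rw [← hsum]; ring

end Walk

/-! ## §2 Zero-sum localised source ∘ smooth leg -/

section ZeroSum

variable {D : ℕ} {F : Type*} [Fintype F]

/-- `t·e^{−κt} ≤ (2/κ)·e^{−(κ/2)t}` for every real `t`, `κ > 0` (from `x + 1 ≤ e^x` at `x = (κ/2)t`). [folklore] -/
theorem mul_exp_neg_le {κ : ℝ} (hκ : 0 < κ) (t : ℝ) : t * Real.exp (-κ * t) ≤ (2 / κ) * Real.exp (-(κ / 2) * t) := by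
  have h1 : (κ / 2) * t ≤ Real.exp ((κ / 2) * t) := by
    have := Real.add_one_le_exp ((κ / 2) * t); linarith
  have h2 : t ≤ (2 / κ) * Real.exp ((κ / 2) * t) := by
    have hk : 0 < κ / 2 := by positivity
    calc t = (2 / κ) * ((κ / 2) * t) := by field_simp
      _ ≤ (2 / κ) * Real.exp ((κ / 2) * t) := mul_le_mul_of_nonneg_left h1 (by positivity)
  calc t * Real.exp (-κ * t) ≤ ((2 / κ) * Real.exp ((κ / 2) * t)) * Real.exp (-κ * t) :=
        mul_le_mul_of_nonneg_right h2 (Real.exp_pos _).le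
    _ = (2 / κ) * Real.exp (-(κ / 2) * t) := by
        rw [mul_assoc, ← Real.exp_add]; congr 2; ring

omit [Fintype F] in
/-- Rows of a bi-localised kernel are summable. [folklore] -/
theorem summable_row_of_biLoc {X : MKer D F} {p q : Fin D → ℤ} {CX δX : ℝ} (hX : BiLoc X p q CX δX) (hδX : 0 < δX)
    (x : Fin D → ℤ) (a f : F) : Summable fun y : Fin D → ℤ => X x y a f := by
  refine Summable.of_norm_bounded ((summable_exp_shift' hδX q).mul_left (CX * Real.exp (-δX * l1 (x - p)))) (fun y => ?_)
  rw [Real.norm_eq_abs]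
  refine (hX x y a f).trans (le_of_eq ?_)
  rw [show -δX * (l1 (x - p) + l1 (y - q)) = -δX * l1 (x - p) + -δX * l1 (y - q) by ring, Real.exp_add]; ring

/-- **ZERO-SUM SOURCE ∘ SMOOTH LEG, pointwise**: with `κ := δ_X − 4δ > 0`,
`|(X ∘ J)(x, z)| ≤ |F|·C_X·ε·(2/κ)·Zl_D(κ/2)·e^{−δ_X|x−p|₁}·e^{−δ|z−q|₁}`. [folklore] -/
theorem abs_comp_zeroSum_le {X J : MKer D F} {p q : Fin D → ℤ} {CX δX ε δ B : ℝ} (hX : BiLoc X p q CX δX)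
    (hZ : ∀ x a f, ∑' y, X x y a f = 0) (hJ : Bdd J B) (hε : 0 ≤ ε) (hδ : 0 ≤ δ) (hκ : 4 * δ < δX)
    (hD : ∀ μ y z f b, |J (y + unitVec μ) z f b - J y z f b| ≤ ε * Real.exp (-δ * l1 (y - z)))
    (x z : Fin D → ℤ) (a b : F) :
    |comp X J x z a b| ≤ (Fintype.card F : ℝ) * (CX * ε) * ((2 / (δX - 4 * δ)) * Zl D ((δX - 4 * δ) / 2)) *
        Real.exp (-δX * l1 (x - p)) * Real.exp (-δ * l1 (z - q)) := by
  classical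
  have hδX : 0 < δX := by linarith
  have hCX : 0 ≤ CX := hX.nonneg a
  set κ := δX - 4 * δ with hκdef
  have hκ0 : 0 < κ := by rw [hκdef]; linarith
  -- subtract the reference `J q z f b` using the zero sums
  have hrow : ∀ f, Summable fun y => X x y a f := fun f => summable_row_of_biLoc hX hδX x a f
  have hsJ : ∀ f, Summable fun y => X x y a f * J y z f b := fun f =>
    Summable.of_norm_bounded ((hrow f).abs.mul_right B) (fun y => by
      rw [Real.norm_eq_abs, abs_mul]; exact mul_le_mul_of_nonneg_left (hJ y z f b) (abs_nonneg _))
  have hsR : ∀ f, Summable fun y => X x y a f * J q z f b := fun f => (hrow f).mul_right _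
  have e : comp X J x z a b = ∑' y, ∑ f, X x y a f * (J y z f b - J q z f b) := by
    unfold ExpKernelCalculus.comp
    have h0 : ∑' y, ∑ f, X x y a f * J q z f b = 0 := by
      rw [Summable.tsum_finsetSum (fun f _ => hsR f)]
      refine Finset.sum_eq_zero fun f _ => ?_
      rw [tsum_mul_right, hZ x a f, zero_mul]
    rw [← sub_zero (∑' y, ∑ f, X x y a f * J y z f b), ← h0,
      ← (summable_sum fun f _ => hsJ f).tsum_sub (summable_sum fun f _ => hsR f)]
    refine tsum_congr fun y => ?_
    rw [← Finset.sum_sub_distrib]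
    refine Finset.sum_congr rfl fun f _ => ?_
    ring
  rw [e]
  -- termwise bound
  have hterm : ∀ y, |∑ f, X x y a f * (J y z f b - J q z f b)|
      ≤ ((Fintype.card F : ℝ) * (CX * ε) * (2 / κ) * Real.exp (-δX * l1 (x - p)) * Real.exp (-δ * l1 (z - q))) *
          Real.exp (-(κ / 2) * l1 (y - q)) := by
    intro y
    have hosc : ∀ f, |J y z f b - J q z f b| ≤ l1 (y - q) * ε * Real.exp (3 * δ * l1 (y - q)) * Real.exp (-δ * l1 (y - z)) :=
      fun f => abs_sub_le_of_fwdDiff (g := fun w => J w z f b) hε hδ (fun μ w => hD μ w z f b) y q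
    have hyz : Real.exp (-δ * l1 (y - z)) ≤ Real.exp (δ * l1 (y - q)) * Real.exp (-δ * l1 (z - q)) := by
      rw [← Real.exp_add, Real.exp_le_exp]
      have ht := l1_sub_triangle z y q
      rw [l1_sub_symm z y] at ht
      nlinarith [ht, l1_nonneg (y - q), l1_nonneg (z - q)]
    have hone : ∀ f, |X x y a f * (J y z f b - J q z f b)| ≤
        (CX * ε) * Real.exp (-δX * l1 (x - p)) * Real.exp (-δ * l1 (z - q)) * (l1 (y - q) * Real.exp (-κ * l1 (y - q))) := by
      intro f
      rw [abs_mul]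
      have hXb := hX x y a f
      calc |X x y a f| * |J y z f b - J q z f b|
          ≤ (CX * Real.exp (-δX * (l1 (x - p) + l1 (y - q)))) *
              (l1 (y - q) * ε * Real.exp (3 * δ * l1 (y - q)) * (Real.exp (δ * l1 (y - q)) * Real.exp (-δ * l1 (z - q)))) :=
            mul_le_mul hXb ((hosc f).trans (mul_le_mul_of_nonneg_left hyz
              (mul_nonneg (mul_nonneg (l1_nonneg _) hε) (Real.exp_pos _).le))) (abs_nonneg _)
              (mul_nonneg hCX (Real.exp_pos _).le)
        _ = (CX * ε) * Real.exp (-δX * l1 (x - p)) * Real.exp (-δ * l1 (z - q)) *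
              (l1 (y - q) * (Real.exp (-δX * l1 (y - q)) * Real.exp (3 * δ * l1 (y - q)) * Real.exp (δ * l1 (y - q)))) := by
            rw [show -δX * (l1 (x - p) + l1 (y - q)) = -δX * l1 (x - p) + -δX * l1 (y - q) by ring, Real.exp_add]; ring
        _ = (CX * ε) * Real.exp (-δX * l1 (x - p)) * Real.exp (-δ * l1 (z - q)) * (l1 (y - q) * Real.exp (-κ * l1 (y - q))) := by
            rw [← Real.exp_add, ← Real.exp_add]; congr 2; rw [hκdef]; ring_nf
    have hml := mul_exp_neg_le hκ0 (l1 (y - q))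
    calc |∑ f, X x y a f * (J y z f b - J q z f b)| ≤ ∑ f, |X x y a f * (J y z f b - J q z f b)| := Finset.abs_sum_le_sum_abs _ _
      _ ≤ ∑ _f : F, (CX * ε) * Real.exp (-δX * l1 (x - p)) * Real.exp (-δ * l1 (z - q)) * (l1 (y - q) * Real.exp (-κ * l1 (y - q))) :=
          Finset.sum_le_sum fun f _ => hone f
      _ ≤ ∑ _f : F, (CX * ε) * Real.exp (-δX * l1 (x - p)) * Real.exp (-δ * l1 (z - q)) * ((2 / κ) * Real.exp (-(κ / 2) * l1 (y - q))) :=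
          Finset.sum_le_sum fun f _ => mul_le_mul_of_nonneg_left hml (by positivity)
      _ = _ := by rw [Finset.sum_const, Finset.card_univ, nsmul_eq_mul]; ring
  have hs := summable_exp_shift' (show 0 < κ / 2 by positivity) q
  have hmaj := hs.mul_left ((Fintype.card F : ℝ) * (CX * ε) * (2 / κ) * Real.exp (-δX * l1 (x - p)) * Real.exp (-δ * l1 (z - q)))
  have hb := tsum_of_norm_bounded hmaj.hasSum (fun y => by rw [Real.norm_eq_abs]; exact hterm y)
  rw [Real.norm_eq_abs] at hb
  refine hb.trans (le_of_eq ?_)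
  rw [tsum_mul_left, tsum_exp_shift']
  ring

/-- **ZERO-SUM SOURCE ∘ SMOOTH LEG IS BI-LOCALISED WITH CONSTANT `∝ C_X·ε`**: `BiLoc X p q C_X δ_X`, zero sums of `X` in its second variable,
bounded `J` with forward differences `≤ ε·e^{−δ|y−z|₁}` in its first variable, `0 ≤ δ`, `4δ < δ_X` ⇒
`BiLoc (comp X J) p q (|F|·(C_X·ε)·((2/(δ_X − 4δ))·Zl_D((δ_X − 4δ)/2))) δ` — the leg's SIZE does not enter. [folklore] -/
theorem biLoc_comp_of_zeroSum {X J : MKer D F} {p q : Fin D → ℤ} {CX δX ε δ B : ℝ} (hX : BiLoc X p q CX δX)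
    (hZ : ∀ x a f, ∑' y, X x y a f = 0) (hJ : Bdd J B) (hε : 0 ≤ ε) (hδ : 0 ≤ δ) (hκ : 4 * δ < δX)
    (hD : ∀ μ y z f b, |J (y + unitVec μ) z f b - J y z f b| ≤ ε * Real.exp (-δ * l1 (y - z))) :
    BiLoc (comp X J) p q ((Fintype.card F : ℝ) * (CX * ε) * ((2 / (δX - 4 * δ)) * Zl D ((δX - 4 * δ) / 2))) δ := by
  intro x z a b
  refine (abs_comp_zeroSum_le hX hZ hJ hε hδ hκ hD x z a b).trans ?_
  have hδX : δ ≤ δX := by linarith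
  rw [show -δ * (l1 (x - p) + l1 (z - q)) = -δ * l1 (x - p) + -δ * l1 (z - q) by ring, Real.exp_add, mul_assoc]
  refine mul_le_mul_of_nonneg_left (mul_le_mul_of_nonneg_right (Real.exp_le_exp.mpr ?_) (Real.exp_pos _).le) ?_
  · nlinarith [l1_nonneg (x - p)]
  · have hCX : 0 ≤ CX := hX.nonneg a
    have hκ0 : 0 < δX - 4 * δ := by linarith
    have hZl : 0 ≤ Zl D ((δX - 4 * δ) / 2) := ExpKernelCalculus.Zl_nonneg (by positivity)
    positivity

end ZeroSum

end Summit.QuantumFields.BalabanUV.Beta.GAN24.WoodburyFibreZeroSumGain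

end
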